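import Literature.NumberTheory.LFunctions.SelbergApproxPointwise
import Literature.NumberTheory.LFunctions.ZetaLogDerivRH
import HarnessLib

/-!
# `ζ(½ + it) = O(exp(A log t / log log t))` under RH (Titchmarsh (14.14.1))

Topic `Literature/NumberTheory/LFunctions`. Everything in this file is PROVED (theorems only; no
definitions, no named facts).

Titchmarsh, *The Theory of the Riemann Zeta-Function*, Theorem 14.14 (A) (§14.14; PDF page 260 of
the held copy `book:titchmarsh1986-theory-riemann-zeta-function-2nd-ed-revised`, read):
"`ζ(½ + it) = O{exp(A log t / log log t)}` (14.14.1)" on the Riemann hypothesis.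
Titchmarsh derives it from Selberg's machinery for `S(t)` (Theorem 14.13). Here we obtain it from
the part of Selberg's method already in the tree (the unconditional §14.21 files
`SelbergExplicitFormula.lean`, `SelbergSigmaXT.lean`, `SelbergApproxPointwise.lean`, and the
horizontal-ray calculus of `ZetaArgVariation.lean`), by running the proof of
`Literature.NumberTheory.LFunctions.SelbergApprox.selberg_approx_pointwise` with REAL parts:

* `log |ζ(½+it)| = −Re ∫_{½}^{∞} ζ'/ζ(σ+it) dσ` (`log_norm_zeta_half_eq_neg_re_integral`);
* on `σ ≥ σ₁ = ½ + δ₁` (`δ₁ = SelbergSigma.delta ℓ t`, `= 4/ℓ` under RH since all zeros have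
  `|β − ½| = 0`): the explicit formula with Selberg's weights `Λ_x` (`x = e^ℓ`) and its majorant
  `K e^{−(σ−σ₁)} + (3/10) W e^{−(σ−σ₁)ℓ}` (`SelbergApprox.norm_logDeriv_add_fordK_le_majorant`);
* on `½ ≤ σ ≤ σ₁`: `ζ'/ζ(s₁) − ζ'/ζ(s) = Σ_ρ m(ρ)(1/(s₁−ρ) − 1/(s−ρ)) − (pole and Γ terms)` and,
  under RH, `Re 1/(s−ρ) ≥ 0`, so the real part of the zero sum integrates to at most `δ₁ W(t)`
  (`re_integral_segment_le`) — this positivity is the only place RH enters beyond `δ₁ = 4/ℓ`;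
* `W ≤ 6‖D(s₁)‖ + C log t` (`SelbergSigma.W_le`) and crude bounds `‖D‖, ‖M‖ ≤ 4e^{6ℓ}` for the
  Dirichlet polynomials; the choice `ℓ = (log log t)/12` gives (14.14.1)
  (`exists_log_norm_zeta_half_le_of_RH`, `exists_norm_zeta_half_le_exp_of_RH`).

## References

* E. C. Titchmarsh, *The Theory of the Riemann Zeta-Function*, 2nd ed. revised by
  D. R. Heath-Brown (1986), Thm. 14.14 (A), eq. (14.14.1); §14.21. [cite: Titchmarsh1986, Thm. 14.14 (A)]
* A. Selberg, Arch. Math. Naturvid. 48 (1946) no. 5.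
* K. Soundararajan, Moments of the Riemann zeta function, Ann. of Math. 170 (2009), 981–993,
  §2 (the same bound with the sharp constant; not needed here).
-/

noncomputable section

open Complex Real MeasureTheory Set Filter Topology intervalIntegral
open scoped ComplexConjugate

namespace Literature.NumberTheory.LFunctions

namespace CriticalLineRH

/-! ## What RH gives: no ordinates off the line, `V = 0`, `δ₁ = 4/ℓ` -/

/-- Under RH, if `ζ(½ + it) ≠ 0` and `t > 0`, then `t` is not the ordinate of any zero of `ζ`.
[folklore] -/
theorem not_ordinate_of_RH (hRH : RiemannHypothesis) {t : ℝ} (ht : 0 < t)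
    (h0 : riemannZeta (1 / 2 + t * I) ≠ 0) : ∀ ρ : ℂ, riemannZeta ρ = 0 → ρ.im ≠ t := by
  intro ρ hρ hρt
  have hntriv : ¬∃ n : ℕ, ρ = -2 * (n + 1) := by
    rintro ⟨n, hn⟩
    have := congrArg Complex.im hn
    simp at this
    linarith
  have hρ1 : ρ ≠ 1 := fun h ↦ by rw [h, Complex.one_im] at hρt; linarith
  have hre : ρ.re = 1 / 2 := hRH ρ hρ hntriv hρ1
  have : ρ = 1 / 2 + t * I := Complex.ext (by simp [hre]) (by simp [hρt])
  exact h0 (this ▸ hρ)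

/-- Under RH every non-trivial zero has `|Re ρ − ½| = 0`. [folklore] -/
theorem dev_eq_zero_of_RH (hRH : RiemannHypothesis) {ρ : ℂ}
    (hρ : ρ ∈ RHWave0.riemannZetaNontrivialZeros) : SelbergSigma.dev ρ = 0 := by
  rw [SelbergSigma.dev, re_eq_one_half_of_riemannHypothesis hRH
    (ZetaZeros.riemannZetaNontrivialZeros.zeta_eq_zero hρ)
    (ZetaZeros.riemannZetaNontrivialZeros.re_pos hρ)]
  simp

/-- Under RH, Selberg's `V(t) = 0`. [folklore] -/
theorem V_eq_zero_of_RH (hRH : RiemannHypothesis) {ℓ : ℝ} (hℓ : 0 < ℓ) (t : ℝ) :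
    SelbergSigma.V ℓ t = 0 := by
  rcases SelbergSigma.V_eq_zero_or_exists hℓ t with h | ⟨ρ, hρ, -, h⟩
  · exact h
  · rw [h, dev_eq_zero_of_RH hRH hρ]

/-- Under RH, Selberg's abscissa is Titchmarsh's: `δ₁ = σ_{x,t} − ½ = 4/ℓ`. [folklore] -/
theorem delta_eq_of_RH (hRH : RiemannHypothesis) {ℓ : ℝ} (hℓ : 0 < ℓ) (t : ℝ) :
    SelbergSigma.delta ℓ t = 4 / ℓ := by
  rw [SelbergSigma.delta, V_eq_zero_of_RH hRH hℓ t, max_eq_right (by positivity)]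
  ring

/-! ## `log |ζ(½ + it)|` as a horizontal integral of `ζ'/ζ` -/

/-- `log ‖ζ(b + it)‖ → 0` as `b → +∞` (`|log ‖ζ‖| ≤ 4e^{−(log 2)b}` for `b ≥ 3`). [folklore] -/
theorem tendsto_log_norm_zeta_atTop (t : ℝ) :
    Tendsto (fun b : ℝ ↦ Real.log ‖riemannZeta (b + t * I)‖) atTop (𝓝 0) := by
  have hbound : ∀ᶠ b : ℝ in atTop,
      ‖Real.log ‖riemannZeta (b + t * I)‖‖ ≤ 4 * Real.exp (-Real.log 2 * b) := by
    filter_upwards [eventually_ge_atTop 3] with b hb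
    rw [Real.norm_eq_abs]
    exact abs_log_norm_riemannZeta_le_of_three_le hb t
  have hlim : Tendsto (fun b : ℝ ↦ 4 * Real.exp (-Real.log 2 * b)) atTop (𝓝 0) := by
    have h1 : Tendsto (fun b : ℝ ↦ -Real.log 2 * b) atTop atBot :=
      tendsto_id.const_mul_atTop_of_neg (by
        have := Real.log_pos (show (1 : ℝ) < 2 by norm_num); linarith)
    have := (Real.tendsto_exp_atBot.comp h1).const_mul 4
    simpa using this
  exact squeeze_zero_norm' hbound hlim

/-- **`log ‖ζ(½ + it)‖ = −Re ∫_{½}^{∞} ζ'/ζ(σ + it) dσ`** for `t > 0` not the ordinate of a zero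
(the horizontal fundamental theorem of calculus for `log ‖ζ‖`, `ZetaArgVariation`'s
`integral_re_logDeriv_horizontal`, and `log ‖ζ(b+it)‖ → 0`). [cite: Titchmarsh1986, §14.21] -/
theorem log_norm_zeta_half_eq_neg_re_integral {t : ℝ} (ht : 0 < t)
    (hT' : ∀ ρ : ℂ, riemannZeta ρ = 0 → ρ.im ≠ t) :
    Real.log ‖riemannZeta (1 / 2 + t * I)‖ =
      -(∫ σ in Ioi (1 / 2 : ℝ), deriv riemannZeta (σ + t * I) / riemannZeta (σ + t * I)).re := by
  set F : ℝ → ℂ := fun σ ↦ deriv riemannZeta (σ + t * I) / riemannZeta (σ + t * I) with hF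
  have hint : IntegrableOn F (Ioi (1 / 2 : ℝ)) := integrableOn_logDeriv_riemannZeta_Ioi_half ht hT'
  have hre : ∫ σ in Ioi (1 / 2 : ℝ), (F σ).re = (∫ σ in Ioi (1 / 2 : ℝ), F σ).re := integral_re hint
  have hintre : IntegrableOn (fun σ ↦ (F σ).re) (Ioi (1 / 2 : ℝ)) := by
    have h := Complex.reCLM.integrable_comp hint
    unfold IntegrableOn
    simpa using h
  have hζne : ∀ σ : ℝ, riemannZeta (σ + t * I) ≠ 0 := fun σ h ↦ hT' _ h (by simp)
  have hne1 : ∀ σ : ℝ, (σ : ℂ) + t * I ≠ 1 := fun σ h ↦ by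
    have := congrArg Complex.im h; simp at this; exact ht.ne' this
  have hftc : ∀ b : ℝ, 1 / 2 ≤ b → ∫ σ in (1 / 2 : ℝ)..b, (F σ).re =
      Real.log ‖riemannZeta (b + t * I)‖ - Real.log ‖riemannZeta ((1 / 2 : ℝ) + t * I)‖ :=
    fun b hb ↦ integral_re_logDeriv_horizontal hb (fun x _ ↦ analyticOn_riemannZeta _ (hne1 x))
      (fun x _ ↦ hζne x)
  have h1 : Tendsto (fun b : ℝ ↦ ∫ σ in (1 / 2 : ℝ)..b, (F σ).re) atTop
      (𝓝 (∫ σ in Ioi (1 / 2 : ℝ), (F σ).re)) :=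
    intervalIntegral_tendsto_integral_Ioi (1 / 2) hintre tendsto_id
  have h2 : Tendsto (fun b : ℝ ↦ ∫ σ in (1 / 2 : ℝ)..b, (F σ).re) atTop
      (𝓝 (0 - Real.log ‖riemannZeta ((1 / 2 : ℝ) + t * I)‖)) := by
    refine ((tendsto_log_norm_zeta_atTop t).sub_const _).congr' ?_
    filter_upwards [eventually_ge_atTop (1 / 2 : ℝ)] with b hb
    exact (hftc b hb).symm
  have h12 := tendsto_nhds_unique h1 h2
  rw [← hre, h12]
  push_cast
  ring

/-! ## The segment `½ ≤ σ ≤ σ₁` under RH -/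

/-- **The segment under RH.** For `t ≥ 1` not an ordinate, `ℓ > 4`, `δ₁ = delta ℓ t`,
`σ₁ = ½ + δ₁`, `s₁ = σ₁ + it`:
`Re ∫_{½}^{σ₁} (ζ'/ζ(s₁) − ζ'/ζ(σ+it)) dσ ≤ δ₁ W(t) + δ₁ (4/t + log(|t|+4) + 10)`.
The difference is `Σ_ρ m(ρ)(1/(s₁−ρ) − 1/(s−ρ))` minus the pole and `Γ` terms
(`SelbergApprox.logDeriv_zeta_eq_line`, `hasSum_zeroOrder_mul_inv_sub_sub`,
`SelbergApprox.norm_bracket_le`); the zero sum is integrated termwise (dominated convergence, as in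
`SelbergApprox.selberg_approx_pointwise`), and under RH `Re 1/(s−ρ) = (σ−½)/|s−ρ|² ≥ 0` while
`Re 1/(s₁−ρ) = δ₁/(δ₁² + (t−γ)²) = w_ρ`. [cite: Titchmarsh1986, §14.21 (J₃)] -/
theorem re_integral_segment_le (hRH : RiemannHypothesis) {ℓ t : ℝ} (hℓ : 4 < ℓ) (ht : 1 ≤ t)
    (hT' : ∀ ρ : ℂ, riemannZeta ρ = 0 → ρ.im ≠ t) :
    (∫ σ in (1 / 2 : ℝ)..(1 / 2 + SelbergSigma.delta ℓ t),
        (deriv riemannZeta (((1 / 2 + SelbergSigma.delta ℓ t : ℝ) : ℂ) + t * I) /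
            riemannZeta (((1 / 2 + SelbergSigma.delta ℓ t : ℝ) : ℂ) + t * I) -
          deriv riemannZeta (σ + t * I) / riemannZeta (σ + t * I))).re ≤
      SelbergSigma.delta ℓ t * SelbergSigma.W ℓ t +
        (4 / t + Real.log (|t| + 4) + 10) * SelbergSigma.delta ℓ t := by
  have hℓ0 : 0 < ℓ := by linarith
  have ht0 : 0 < t := by linarith
  have ht0' : t ≠ 0 := ht0.ne'
  set δ := SelbergSigma.delta ℓ t with hδ
  have hδ0 : 0 < δ := SelbergSigma.delta_pos hℓ0 t
  have hδ1 : δ < 1 := SelbergSigma.delta_lt_one hℓ t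
  set σ₁ : ℝ := 1 / 2 + δ with hσ₁
  have hσ₁h : (1 / 2 : ℝ) ≤ σ₁ := by rw [hσ₁]; linarith
  have hσ₁32 : σ₁ ≤ 3 / 2 := by rw [hσ₁]; linarith
  have hζline : ∀ σ : ℝ, riemannZeta (σ + t * I) ≠ 0 := fun σ h ↦ hT' _ h (by simp)
  set Fc : ℝ → ℂ := fun σ ↦ deriv riemannZeta (σ + t * I) / riemannZeta (σ + t * I) with hFc
  -- integrability of `Fc` on the segment
  have hFint : IntegrableOn Fc (Ioi (1 / 2 : ℝ)) := integrableOn_logDeriv_riemannZeta_Ioi_half ht0 hT'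
  have hF1 : IntegrableOn Fc (Ioc (1 / 2 : ℝ) σ₁) := hFint.mono_set Ioc_subset_Ioi_self
  have hFii : IntervalIntegrable Fc volume (1 / 2) σ₁ :=
    (intervalIntegrable_iff_integrableOn_Ioc_of_le hσ₁h).2 hF1
  -- the bracket `B` and the zero part `Zf`
  set B : ℝ → ℂ := fun σ ↦ (1 / ((σ₁ : ℂ) + t * I) - 1 / ((σ : ℂ) + t * I)) +
    (1 / ((σ₁ : ℂ) + t * I - 1) - 1 / ((σ : ℂ) + t * I - 1)) +
    (logDeriv Gammaℝ ((σ₁ : ℂ) + t * I) - logDeriv Gammaℝ ((σ : ℂ) + t * I)) with hB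
  set gz : RHWave0.riemannZetaNontrivialZeros → ℝ → ℂ := fun ρ σ ↦
    (riemannZetaZeroOrder (ρ : ℂ) : ℂ) * (1 / (((σ₁ : ℂ)) + t * I - ρ) - 1 / (((σ : ℂ)) + t * I - ρ))
    with hgz
  set Zf : ℝ → ℂ := fun σ ↦ ∑' ρ : RHWave0.riemannZetaNontrivialZeros, gz ρ σ with hZf
  have hsumZ : ∀ σ : ℝ, HasSum (fun ρ ↦ gz ρ σ)
      (logDeriv riemannXi ((σ₁ : ℂ) + t * I) - logDeriv riemannXi (σ + t * I)) :=
    fun σ ↦ hasSum_zeroOrder_mul_inv_sub_sub (hζline σ₁) (hζline σ)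
  have hZf_eq : ∀ σ : ℝ, Zf σ = logDeriv riemannXi ((σ₁ : ℂ) + t * I) - logDeriv riemannXi (σ + t * I) :=
    fun σ ↦ (hsumZ σ).tsum_eq
  have hdiff : ∀ σ : ℝ, 1 / 2 ≤ σ → Fc σ₁ - Fc σ = Zf σ - B σ := by
    intro σ hσ
    rw [hZf_eq σ, hFc, hB]
    simp only
    rw [SelbergApprox.logDeriv_zeta_eq_line hσ₁h ht0' (hζline σ₁),
      SelbergApprox.logDeriv_zeta_eq_line hσ ht0' (hζline σ)]
    ring
  -- continuity / integrability of `B` on `[½, σ₁]`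
  have hBcont : ContinuousOn B (Set.uIcc (1 / 2 : ℝ) σ₁) := by
    rw [Set.uIcc_of_le hσ₁h]
    intro σ hσ
    have hσ0 : 0 < ((σ : ℂ) + t * I).re := by simp; linarith [hσ.1]
    have hne0 : (σ : ℂ) + t * I ≠ 0 := fun h ↦ ht0' (by have := congrArg Complex.im h; simpa using this)
    have hne1 : (σ : ℂ) + t * I - 1 ≠ 0 := fun h ↦ ht0' (by have := congrArg Complex.im h; simpa using this)
    have hline : Continuous fun σ : ℝ ↦ (σ : ℂ) + t * I := by fun_prop
    refine ContinuousAt.continuousWithinAt ?_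
    have c1 : ContinuousAt (fun σ : ℝ ↦ 1 / ((σ : ℂ) + t * I)) σ :=
      continuousAt_const.div hline.continuousAt hne0
    have c2 : ContinuousAt (fun σ : ℝ ↦ 1 / ((σ : ℂ) + t * I - 1)) σ :=
      continuousAt_const.div (hline.continuousAt.sub continuousAt_const) hne1
    have c3 : ContinuousAt (fun σ : ℝ ↦ logDeriv Gammaℝ ((σ : ℂ) + t * I)) σ :=
      ContinuousAt.comp (f := fun σ : ℝ ↦ (σ : ℂ) + t * I) (analyticAt_logDeriv_Gammaℝ hσ0).continuousAt
        hline.continuousAt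
    rw [hB]
    exact ((continuousAt_const.sub c1).add (continuousAt_const.sub c2)).add (continuousAt_const.sub c3)
  have hBii : IntervalIntegrable B volume (1 / 2) σ₁ := hBcont.intervalIntegrable
  have hZfii : IntervalIntegrable Zf volume (1 / 2) σ₁ := by
    have h1 : IntervalIntegrable (fun σ ↦ (Fc σ₁ - Fc σ) + B σ) volume (1 / 2) σ₁ :=
      (intervalIntegrable_const.sub hFii).add hBii
    refine h1.congr ?_
    rw [Set.uIoc_of_le hσ₁h]
    intro σ hσ
    simp only
    rw [hdiff σ (le_of_lt hσ.1)]; ring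
  have hJ3 : ∫ σ in (1 / 2 : ℝ)..σ₁, (Fc σ₁ - Fc σ) =
      (∫ σ in (1 / 2 : ℝ)..σ₁, Zf σ) - ∫ σ in (1 / 2 : ℝ)..σ₁, B σ := by
    rw [← intervalIntegral.integral_sub hZfii hBii]
    refine intervalIntegral.integral_congr fun σ hσ ↦ ?_
    rw [Set.uIcc_of_le hσ₁h] at hσ
    exact hdiff σ hσ.1
  -- `‖∫ B‖ ≤ δ (4/t + log(|t|+4) + 10)`
  have hBnorm : ‖∫ σ in (1 / 2 : ℝ)..σ₁, B σ‖ ≤ (4 / t + Real.log (|t| + 4) + 10) * δ := by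
    have h := intervalIntegral.norm_integral_le_of_norm_le_const (a := 1 / 2) (b := σ₁) (f := B)
      (C := 4 / t + Real.log (|t| + 4) + 10) ?_
    · rwa [show σ₁ - 1 / 2 = δ by rw [hσ₁]; ring, abs_of_pos hδ0] at h
    · intro σ hσ
      rw [Set.uIoc_of_le hσ₁h] at hσ
      exact SelbergApprox.norm_bracket_le (le_of_lt hσ.1) hσ₁32 hσ.2 ht
  ------------------------------------------------------------------
  -- `Re ∫ Zf ≤ δ W` via termwise integration and RH
  ------------------------------------------------------------------
  obtain ⟨c, hc0, hc⟩ := SelbergApprox.exists_pos_mul_le_sq_sub_im hT'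
  set bound : RHWave0.riemannZetaNontrivialZeros → ℝ → ℝ := fun ρ _ ↦
    δ / c * ((riemannZetaZeroOrder (ρ : ℂ) : ℝ) / (1 + (ρ : ℂ).im ^ 2)) with hbound
  have hbsum : Summable fun ρ : RHWave0.riemannZetaNontrivialZeros ↦
      δ / c * ((riemannZetaZeroOrder (ρ : ℂ) : ℝ) / (1 + (ρ : ℂ).im ^ 2)) :=
    ZetaZeroSum.summable_zeroOrder_div_one_add_sq.mul_left _
  have hgz_cont : ∀ ρ : RHWave0.riemannZetaNontrivialZeros, Continuous (gz ρ) := by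
    intro ρ
    rw [hgz]
    refine continuous_const.mul (continuous_const.sub ?_)
    refine Continuous.div continuous_const (by fun_prop) fun σ h0 ↦ ?_
    have := congrArg Complex.im h0
    simp at this
    exact hT' ρ (ZetaZeros.riemannZetaNontrivialZeros.zeta_eq_zero ρ.2) (by linarith)
  have hgz_bound : ∀ (ρ : RHWave0.riemannZetaNontrivialZeros) (σ : ℝ), σ ∈ Set.uIoc (1 / 2 : ℝ) σ₁ →
      ‖gz ρ σ‖ ≤ bound ρ σ := by
    intro ρ σ hσ
    rw [Set.uIoc_of_le hσ₁h] at hσ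
    have hm := ZetaZeroSum.zeroOrder_nonneg ρ
    have hd2 := hc ρ ρ.2
    have hpos : 0 < 1 + (ρ : ℂ).im ^ 2 := by positivity
    have hdpos : 0 < (t - (ρ : ℂ).im) ^ 2 := lt_of_lt_of_le (by positivity) hd2
    rw [hgz, hbound]
    simp only
    rw [norm_mul, Complex.norm_intCast, abs_of_nonneg hm]
    have hρζ := ZetaZeros.riemannZetaNontrivialZeros.zeta_eq_zero ρ.2
    have hne1 : ((σ₁ : ℂ)) + t * I - ρ ≠ 0 := sub_ne_zero.2 fun e ↦ hζline σ₁ (e ▸ hρζ)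
    have hne : ((σ : ℂ)) + t * I - ρ ≠ 0 := sub_ne_zero.2 fun e ↦ hζline σ (e ▸ hρζ)
    have hid : 1 / (((σ₁ : ℂ)) + t * I - ρ) - 1 / (((σ : ℂ)) + t * I - ρ) =
        ((σ : ℂ) - σ₁) / ((((σ₁ : ℂ)) + t * I - ρ) * (((σ : ℂ)) + t * I - ρ)) := by
      field_simp; ring
    rw [hid, norm_div, norm_mul]
    have hn1 : |t - (ρ : ℂ).im| ≤ ‖((σ₁ : ℂ)) + t * I - ρ‖ := by
      have := Complex.abs_im_le_norm (((σ₁ : ℂ)) + t * I - ρ); simpa using this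
    have hn : |t - (ρ : ℂ).im| ≤ ‖((σ : ℂ)) + t * I - ρ‖ := by
      have := Complex.abs_im_le_norm (((σ : ℂ)) + t * I - ρ); simpa using this
    have hnum : ‖(σ : ℂ) - σ₁‖ ≤ δ := by
      rw [show (σ : ℂ) - σ₁ = ((σ - σ₁ : ℝ) : ℂ) by push_cast; ring, Complex.norm_real, Real.norm_eq_abs,
        abs_le]
      constructor <;> linarith [hσ.1, hσ.2]
    have habs0 : 0 < |t - (ρ : ℂ).im| := by
      refine abs_pos.2 fun h0 ↦ ?_
      rw [h0] at hdpos; simp at hdpos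
    have hden : |t - (ρ : ℂ).im| * |t - (ρ : ℂ).im| ≤ ‖((σ₁ : ℂ)) + t * I - ρ‖ * ‖((σ : ℂ)) + t * I - ρ‖ :=
      mul_le_mul hn1 hn (abs_nonneg _) (norm_nonneg _)
    calc (riemannZetaZeroOrder (ρ : ℂ) : ℝ) * (‖(σ : ℂ) - σ₁‖ / (‖((σ₁ : ℂ)) + t * I - ρ‖ * ‖((σ : ℂ)) + t * I - ρ‖))
        ≤ (riemannZetaZeroOrder (ρ : ℂ) : ℝ) * (δ / (|t - (ρ : ℂ).im| * |t - (ρ : ℂ).im|)) :=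
          mul_le_mul_of_nonneg_left (div_le_div₀ hδ0.le hnum (mul_pos habs0 habs0) hden) hm
      _ = (riemannZetaZeroOrder (ρ : ℂ) : ℝ) * (δ / (t - (ρ : ℂ).im) ^ 2) := by rw [← sq, sq_abs]
      _ ≤ (riemannZetaZeroOrder (ρ : ℂ) : ℝ) * (δ / (c * (1 + (ρ : ℂ).im ^ 2))) :=
          mul_le_mul_of_nonneg_left (div_le_div_of_nonneg_left hδ0.le (by positivity) hd2) hm
      _ = δ / c * ((riemannZetaZeroOrder (ρ : ℂ) : ℝ) / (1 + (ρ : ℂ).im ^ 2)) := by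
          field_simp
  haveI : Countable RHWave0.riemannZetaNontrivialZeros := riemannZetaNontrivialZeros_countable.to_subtype
  have hDC : HasSum (fun ρ ↦ ∫ σ in (1 / 2 : ℝ)..σ₁, gz ρ σ) (∫ σ in (1 / 2 : ℝ)..σ₁, Zf σ) := by
    refine intervalIntegral.hasSum_integral_of_dominated_convergence bound
      (fun ρ ↦ (hgz_cont ρ).aestronglyMeasurable) (fun ρ ↦ ae_of_all _ (hgz_bound ρ))
      (ae_of_all _ fun σ _ ↦ hbsum) ?_ (ae_of_all _ fun σ _ ↦ (hsumZ σ).summable.hasSum)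
    simp only [hbound]
    exact intervalIntegrable_const
  have hResum : HasSum (fun ρ ↦ (∫ σ in (1 / 2 : ℝ)..σ₁, gz ρ σ).re) (∫ σ in (1 / 2 : ℝ)..σ₁, Zf σ).re :=
    Complex.hasSum_re hDC
  -- per-zero bound of the real parts, using RH
  have hper : ∀ ρ : RHWave0.riemannZetaNontrivialZeros, (∫ σ in (1 / 2 : ℝ)..σ₁, gz ρ σ).re ≤
      δ * ((riemannZetaZeroOrder (ρ : ℂ) : ℝ) * SelbergSigma.wt δ t ρ) := by
    intro ρ
    have hm := ZetaZeroSum.zeroOrder_nonneg ρ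
    have hβ : (ρ : ℂ).re = 1 / 2 := re_eq_one_half_of_riemannHypothesis hRH
      (ZetaZeros.riemannZetaNontrivialZeros.zeta_eq_zero ρ.2) (ZetaZeros.riemannZetaNontrivialZeros.re_pos ρ.2)
    have hcont := hgz_cont ρ
    have hre_int : (∫ σ in (1 / 2 : ℝ)..σ₁, gz ρ σ).re = ∫ σ in (1 / 2 : ℝ)..σ₁, (gz ρ σ).re := by
      have := Complex.reCLM.intervalIntegral_comp_comm (hcont.intervalIntegrable (μ := volume) (1 / 2) σ₁)
      simpa using this.symm
    rw [hre_int]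
    have hw : (1 / (((σ₁ : ℂ)) + t * I - ρ)).re = SelbergSigma.wt δ t ρ := by
      have h := SelbergSigma.re_inv_sub_eq_coord δ t (ρ : ℂ)
      rw [hβ, sub_self, sub_zero] at h
      rw [SelbergSigma.wt, ← h, hσ₁]
    have hpt : ∀ σ ∈ Set.Icc (1 / 2 : ℝ) σ₁,
        (gz ρ σ).re ≤ (riemannZetaZeroOrder (ρ : ℂ) : ℝ) * SelbergSigma.wt δ t ρ := by
      intro σ hσ
      have h2 : 0 ≤ (1 / (((σ : ℂ)) + t * I - ρ)).re := by
        rw [IsHadamardSeq.re_inv_sub_eq]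
        refine div_nonneg ?_ (sq_nonneg _)
        simp only [add_re, ofReal_re, mul_re, I_re, mul_zero, ofReal_im, I_im, mul_one, sub_self,
          add_zero, hβ, sub_nonneg]
        exact hσ.1
      have e : (gz ρ σ).re = (riemannZetaZeroOrder (ρ : ℂ) : ℝ) *
          ((1 / (((σ₁ : ℂ)) + t * I - ρ)).re - (1 / (((σ : ℂ)) + t * I - ρ)).re) := by
        rw [hgz]
        simp only [Complex.mul_re, Complex.sub_re, Complex.sub_im, Complex.intCast_re,
          Complex.intCast_im, zero_mul, sub_zero]
      rw [e, hw]
      nlinarith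
    have hcii : IntervalIntegrable (fun σ ↦ (gz ρ σ).re) volume (1 / 2) σ₁ :=
      (Complex.continuous_re.comp hcont).intervalIntegrable _ _
    have hmono := intervalIntegral.integral_mono_on hσ₁h hcii intervalIntegrable_const hpt
    rw [intervalIntegral.integral_const, smul_eq_mul, show σ₁ - 1 / 2 = δ by rw [hσ₁]; ring] at hmono
    exact hmono
  have hZfRe : (∫ σ in (1 / 2 : ℝ)..σ₁, Zf σ).re ≤ δ * SelbergSigma.W ℓ t := by
    have hWsum : HasSum (fun ρ : RHWave0.riemannZetaNontrivialZeros ↦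
        δ * ((riemannZetaZeroOrder (ρ : ℂ) : ℝ) * SelbergSigma.wt δ t ρ)) (δ * SelbergSigma.W ℓ t) := by
      rw [SelbergSigma.W]
      exact (SelbergSigma.summable_zeroOrder_mul_wt hδ0 t).hasSum.mul_left δ
    exact hasSum_le hper hResum hWsum
  -- combine
  rw [hJ3, Complex.sub_re]
  have hBre := abs_le.1 ((Complex.abs_re_le_norm (∫ σ in (1 / 2 : ℝ)..σ₁, B σ)).trans hBnorm)
  linarith [hBre.1, hBre.2]

/-! ## To the right of `σ₁`, and at `σ₁` (no RH needed) -/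

/-- **Right of `σ₁`** (`J₁` of Titchmarsh §14.21, real or imaginary parts alike): with
`D(s) = Σ_{2≤n<N} Λ(n) f_ℓ(log n) n^{−s}` (`3ℓ ≤ log N`), `M = Σ Λ(n) f_ℓ(log n) n^{−s₁}/log n`,
`‖∫_{σ₁}^{∞} ζ'/ζ(σ+it) dσ + M‖ ≤ K + (3/10) W/ℓ`, `K` the constant of
`SelbergApprox.norm_logDeriv_add_fordK_le_majorant`. [cite: Titchmarsh1986, §14.21 (J₁)] -/
theorem norm_integral_right_add_le {ℓ t : ℝ} (hℓ : 8 ≤ ℓ) (ht : 1 ≤ t) (hℓt : ℓ ≤ 2 * Real.log t)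
    (hT' : ∀ ρ : ℂ, riemannZeta ρ = 0 → ρ.im ≠ t) {N : ℕ} (hN : 2 ≤ N) (hxN : 3 * ℓ ≤ Real.log N) :
    ‖(∫ σ in Ioi (1 / 2 + SelbergSigma.delta ℓ t),
        deriv riemannZeta (σ + t * I) / riemannZeta (σ + t * I)) +
        ∑ n ∈ Finset.Ico 2 N, ((ArithmeticFunction.vonMangoldt n : ℝ) : ℂ) *
          (SelbergExplicit.smoothing ℓ (Real.log n) : ℂ) *
          ((n : ℂ) ^ (-((((1 / 2 + SelbergSigma.delta ℓ t : ℝ)) : ℂ) + t * I)) / (Real.log n : ℂ))‖ ≤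
      Real.exp 1 * (4 / ℓ ^ 2 + SelbergExplicit.norm_remainder_le.choose * (1 + Real.log (1 + |t|)) *
          Real.exp (-ℓ) / ℓ ^ 2 +
        (∑' n : ℕ, (ArithmeticFunction.vonMangoldt n : ℝ) * (n : ℝ) ^ (-(5 / 4 : ℝ))) *
          Real.exp (-(ℓ / 4))) +
      3 / 10 * SelbergSigma.W ℓ t / ℓ := by
  have hℓ0 : 0 < ℓ := by linarith
  have ht0 : 0 < t := by linarith
  set δ := SelbergSigma.delta ℓ t with hδ
  set σ₁ : ℝ := 1 / 2 + δ with hσ₁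
  have hσ₁h : (1 / 2 : ℝ) ≤ σ₁ := by rw [hσ₁]; linarith [SelbergSigma.delta_pos hℓ0 t]
  set CJ := SelbergExplicit.norm_remainder_le.choose with hCJdef
  set B₀ : ℝ := ∑' n : ℕ, (ArithmeticFunction.vonMangoldt n : ℝ) * (n : ℝ) ^ (-(5 / 4 : ℝ)) with hB₀
  set W : ℝ := SelbergSigma.W ℓ t with hW
  set Fc : ℝ → ℂ := fun σ ↦ deriv riemannZeta (σ + t * I) / riemannZeta (σ + t * I) with hFc
  set Dc : ℝ → ℂ := fun σ ↦ fordK (SelbergExplicit.smoothing ℓ) (σ + t * I) with hDc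
  have hFint : IntegrableOn Fc (Ioi (1 / 2 : ℝ)) := integrableOn_logDeriv_riemannZeta_Ioi_half ht0 hT'
  have hF2 : IntegrableOn Fc (Ioi σ₁) := hFint.mono_set (Ioi_subset_Ioi hσ₁h)
  obtain ⟨hDint, hDval⟩ := SelbergApprox.integral_Ioi_fordK hℓ0.le hN hxN σ₁ t
  have hJ1 : (∫ σ in Ioi σ₁, Fc σ) + ∑ n ∈ Finset.Ico 2 N, ((ArithmeticFunction.vonMangoldt n : ℝ) : ℂ) *
      (SelbergExplicit.smoothing ℓ (Real.log n) : ℂ) * ((n : ℂ) ^ (-(((σ₁ : ℝ) : ℂ) + t * I)) / (Real.log n : ℂ)) =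
      ∫ σ in Ioi σ₁, (Fc σ + Dc σ) := by
    rw [integral_add hF2 hDint, hDval]
  set K : ℝ := Real.exp 1 * (4 / ℓ ^ 2 + CJ * (1 + Real.log (1 + |t|)) * Real.exp (-ℓ) / ℓ ^ 2 +
    B₀ * Real.exp (-(ℓ / 4))) with hK
  set g : ℝ → ℝ := fun σ ↦ K * Real.exp (-(σ - σ₁)) + 3 / 10 * W * Real.exp (-((σ - σ₁) * ℓ)) with hg
  obtain ⟨hgint, hgval⟩ := SelbergApprox.integral_majorant hℓ0 σ₁ K (3 / 10 * W)
  have hRle : ∀ σ ∈ Ioi σ₁, ‖Fc σ + Dc σ‖ ≤ g σ := by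
    intro σ hσ
    have h := SelbergApprox.norm_logDeriv_add_fordK_le_majorant (ℓ := ℓ) (t := t) (σ := σ) hℓ ht hℓt
      (by rw [← hδ]; exact hσ)
    rw [← hδ, ← hCJdef, ← hB₀, ← hW] at h
    rw [hg]; simp only
    rw [show σ - σ₁ = σ - 1 / 2 - δ by rw [hσ₁]; ring]
    exact h
  have hRnorm : ‖∫ σ in Ioi σ₁, (Fc σ + Dc σ)‖ ≤ K + 3 / 10 * W / ℓ := by
    rw [← hgval]
    exact norm_integral_le_of_norm_le hgint ((ae_restrict_iff' measurableSet_Ioi).2 (ae_of_all _ hRle))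
  rw [hJ1]
  exact hRnorm

/-- **At `σ₁`**: `‖ζ'/ζ(s₁)‖ ≤ ‖D(s₁)‖ + 4/ℓ² + (3/10) W + C_J (1 + log(1+|t|))` (explicit formula
at `s₁ = σ_{x,t} + it`). [cite: Titchmarsh1986, (14.21.4)] -/
theorem norm_logDeriv_sigma1_le {ℓ t : ℝ} (hℓ : 8 ≤ ℓ) (ht : 1 ≤ t) (hℓt : ℓ ≤ 2 * Real.log t) :
    ‖deriv riemannZeta ((((1 / 2 + SelbergSigma.delta ℓ t : ℝ)) : ℂ) + t * I) /
        riemannZeta ((((1 / 2 + SelbergSigma.delta ℓ t : ℝ)) : ℂ) + t * I)‖ ≤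
      ‖fordK (SelbergExplicit.smoothing ℓ) ((((1 / 2 + SelbergSigma.delta ℓ t : ℝ)) : ℂ) + t * I)‖ +
        4 / ℓ ^ 2 + 3 / 10 * SelbergSigma.W ℓ t +
        SelbergExplicit.norm_remainder_le.choose * (1 + Real.log (1 + |t|)) := by
  have hℓ0 : 0 < ℓ := by linarith
  set δ := SelbergSigma.delta ℓ t with hδ
  have hδ1 : δ < 1 := SelbergSigma.delta_lt_one (by linarith) t
  have hδ0 : 0 < δ := SelbergSigma.delta_pos hℓ0 t
  set σ₁ : ℝ := 1 / 2 + δ with hσ₁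
  have hσ₁h : (1 / 2 : ℝ) ≤ σ₁ := by rw [hσ₁]; linarith
  have hσ₁32 : σ₁ < 3 / 2 := by rw [hσ₁]; linarith
  set s₁ : ℂ := ((σ₁ : ℝ) : ℂ) + t * I with hs₁
  set CJ := SelbergExplicit.norm_remainder_le.choose with hCJdef
  obtain ⟨hCJ0, hCJb⟩ := SelbergExplicit.norm_remainder_le.choose_spec
  have hs₁re : s₁.re = σ₁ := by simp [hs₁]
  have hs₁im : s₁.im = t := by simp [hs₁]
  have hJs₁ : ‖SelbergExplicit.remainder ℓ s₁‖ ≤ CJ * (1 + Real.log (1 + |t|)) := by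
    have h := hCJb ℓ hℓ0 s₁ (by rw [hs₁re]; exact hσ₁h)
    rw [hs₁re, hs₁im] at h
    refine h.trans ?_
    have hlog0 : 0 ≤ Real.log (1 + |t|) := Real.log_nonneg (by linarith [abs_nonneg t])
    have hX : 0 ≤ CJ * (1 + Real.log (1 + |t|)) := by positivity
    have hℓ2 : 1 ≤ ℓ ^ 2 := by nlinarith
    have he : Real.exp (-(ℓ * (σ₁ + 1 / 2))) ≤ 1 := by
      rw [Real.exp_le_one_iff]
      have := mul_nonneg hℓ0.le (show 0 ≤ σ₁ + 1 / 2 by linarith)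
      linarith
    calc CJ * (1 + Real.log (1 + |t|)) * Real.exp (-(ℓ * (σ₁ + 1 / 2))) / ℓ ^ 2
        ≤ CJ * (1 + Real.log (1 + |t|)) * Real.exp (-(ℓ * (σ₁ + 1 / 2))) := div_le_self (by positivity) hℓ2
      _ ≤ CJ * (1 + Real.log (1 + |t|)) := mul_le_of_le_one_right hX he
  have h := SelbergApprox.norm_logDeriv_add_fordK_le_of_lt (ℓ := ℓ) (t := t) (σ := σ₁) hℓ ht hℓt
    (by rw [← hδ]) hσ₁32
  rw [← hδ, show (σ₁ - 1 / 2 - δ) * ℓ = 0 by rw [hσ₁]; ring, neg_zero, Real.exp_zero, mul_one] at h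
  have e : ‖deriv riemannZeta s₁ / riemannZeta s₁‖ ≤
      ‖deriv riemannZeta s₁ / riemannZeta s₁ + fordK (SelbergExplicit.smoothing ℓ) s₁‖ +
        ‖fordK (SelbergExplicit.smoothing ℓ) s₁‖ := by
    have := norm_sub_le (deriv riemannZeta s₁ / riemannZeta s₁ + fordK (SelbergExplicit.smoothing ℓ) s₁)
      (fordK (SelbergExplicit.smoothing ℓ) s₁)
    simpa using this
  linarith

/-! ## Crude bounds for the Dirichlet polynomials -/

/-- `‖Λ(n) f_ℓ(log n) n^{−s}‖ ≤ log N` for `2 ≤ n < N`, `Re s ≥ 0`. [folklore] -/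
theorem norm_term_le {ℓ : ℝ} (hℓ : 0 < ℓ) {N n : ℕ} (hn : n ∈ Finset.Ico 2 N) {s : ℂ}
    (hs : 0 ≤ s.re) :
    ‖((ArithmeticFunction.vonMangoldt n : ℝ) : ℂ) * (SelbergExplicit.smoothing ℓ (Real.log n) : ℂ) *
        (n : ℂ) ^ (-s)‖ ≤ Real.log N := by
  obtain ⟨hn2, hnN⟩ := Finset.mem_Ico.1 hn
  have hn0 : 0 < n := by omega
  have hn1 : (1 : ℝ) ≤ n := by exact_mod_cast hn0
  have hN1 : (1 : ℝ) < N := by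
    have : 1 < N := by omega
    exact_mod_cast this
  rw [norm_mul, norm_mul, Complex.norm_real, Complex.norm_real, Real.norm_eq_abs, Real.norm_eq_abs,
    abs_of_nonneg ArithmeticFunction.vonMangoldt_nonneg, Complex.norm_natCast_cpow_of_pos hn0,
    Complex.neg_re]
  have h1 : (ArithmeticFunction.vonMangoldt n : ℝ) ≤ Real.log N :=
    ArithmeticFunction.vonMangoldt_le_log.trans
      (Real.log_le_log (by positivity) (by exact_mod_cast hnN.le))
  have h2 : |SelbergExplicit.smoothing ℓ (Real.log n)| ≤ 1 := SelbergExplicit.abs_smoothing_le_one hℓ _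
  have h3 : (n : ℝ) ^ (-s.re) ≤ 1 := Real.rpow_le_one_of_one_le_of_nonpos hn1 (by linarith)
  have hlogN : 0 ≤ Real.log N := Real.log_nonneg hN1.le
  calc (ArithmeticFunction.vonMangoldt n : ℝ) * |SelbergExplicit.smoothing ℓ (Real.log n)| * (n : ℝ) ^ (-s.re)
      ≤ Real.log N * 1 * 1 :=
        mul_le_mul (mul_le_mul h1 h2 (abs_nonneg _) hlogN) h3 (Real.rpow_nonneg (by positivity) _)
          (by positivity)
    _ = Real.log N := by ring

/-- `‖Λ(n) f_ℓ(log n) n^{−s}/log n‖ ≤ 1` for `2 ≤ n < N`, `Re s ≥ 0`. [folklore] -/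
theorem norm_term_div_log_le {ℓ : ℝ} (hℓ : 0 < ℓ) {N n : ℕ} (hn : n ∈ Finset.Ico 2 N) {s : ℂ}
    (hs : 0 ≤ s.re) :
    ‖((ArithmeticFunction.vonMangoldt n : ℝ) : ℂ) * (SelbergExplicit.smoothing ℓ (Real.log n) : ℂ) *
        ((n : ℂ) ^ (-s) / (Real.log n : ℂ))‖ ≤ 1 := by
  obtain ⟨hn2, hnN⟩ := Finset.mem_Ico.1 hn
  have hn0 : 0 < n := by omega
  have hn1 : (1 : ℝ) ≤ n := by exact_mod_cast hn0
  have hlog : 0 < Real.log n := Real.log_pos (by exact_mod_cast hn2)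
  rw [norm_mul, norm_mul, norm_div, Complex.norm_real, Complex.norm_real, Complex.norm_real,
    Real.norm_eq_abs, Real.norm_eq_abs, Real.norm_eq_abs, abs_of_nonneg ArithmeticFunction.vonMangoldt_nonneg,
    abs_of_pos hlog, Complex.norm_natCast_cpow_of_pos hn0, Complex.neg_re]
  have h1 : (ArithmeticFunction.vonMangoldt n : ℝ) ≤ Real.log n := ArithmeticFunction.vonMangoldt_le_log
  have h2 : |SelbergExplicit.smoothing ℓ (Real.log n)| ≤ 1 := SelbergExplicit.abs_smoothing_le_one hℓ _
  have h3 : (n : ℝ) ^ (-s.re) ≤ 1 := Real.rpow_le_one_of_one_le_of_nonpos hn1 (by linarith)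
  have h4 : (n : ℝ) ^ (-s.re) / Real.log n ≤ 1 / Real.log n :=
    div_le_div_of_nonneg_right h3 hlog.le
  calc (ArithmeticFunction.vonMangoldt n : ℝ) * |SelbergExplicit.smoothing ℓ (Real.log n)| *
        ((n : ℝ) ^ (-s.re) / Real.log n)
      ≤ Real.log n * 1 * (1 / Real.log n) :=
        mul_le_mul (mul_le_mul h1 h2 (abs_nonneg _) hlog.le) h4 (by positivity) (by positivity)
    _ = 1 := by field_simp

/-- A sum over `2 ≤ n < N` of terms of norm `≤ b` (`b ≥ 0`) has norm `≤ N b`. [folklore] -/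
theorem norm_sum_Ico_le {N : ℕ} {g : ℕ → ℂ} {b : ℝ} (hb : 0 ≤ b)
    (hg : ∀ n ∈ Finset.Ico 2 N, ‖g n‖ ≤ b) : ‖∑ n ∈ Finset.Ico 2 N, g n‖ ≤ N * b := by
  refine (norm_sum_le _ _).trans ?_
  refine (Finset.sum_le_card_nsmul _ _ b hg).trans ?_
  rw [nsmul_eq_mul, Nat.card_Ico]
  have : ((N - 2 : ℕ) : ℝ) ≤ N := by exact_mod_cast Nat.sub_le N 2
  nlinarith

/-! ## Assembly -/

/-- **The sizes of the Dirichlet polynomials.** With `N = ⌈x³⌉` (`x = e^ℓ`, `ℓ ≥ 8`) and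
`Re s ≥ 0`: `N ≥ 2`, `3ℓ ≤ log N`, `‖Σ_{n<N} Λ_x(n) n^{−s}‖ ≤ 8e^{4ℓ}` and
`‖Σ_{n<N} Λ_x(n) n^{−s}/log n‖ ≤ 2e^{4ℓ}` (from `Λ(n) ≤ log n`, `0 ≤ f_ℓ ≤ 1`). [folklore] -/
theorem dirichlet_sizes {ℓ : ℝ} (hℓ : 8 ≤ ℓ) {s : ℂ} (hs : 0 ≤ s.re) :
    2 ≤ ⌈Real.exp (3 * ℓ)⌉₊ ∧ 3 * ℓ ≤ Real.log (⌈Real.exp (3 * ℓ)⌉₊ : ℕ) ∧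
      ‖fordK (SelbergExplicit.smoothing ℓ) s‖ ≤ 8 * Real.exp (4 * ℓ) ∧
      ‖∑ n ∈ Finset.Ico 2 ⌈Real.exp (3 * ℓ)⌉₊, ((ArithmeticFunction.vonMangoldt n : ℝ) : ℂ) *
          (SelbergExplicit.smoothing ℓ (Real.log n) : ℂ) * ((n : ℂ) ^ (-s) / (Real.log n : ℂ))‖ ≤
        2 * Real.exp (4 * ℓ) := by
  have hℓ0 : 0 < ℓ := by linarith
  set N : ℕ := ⌈Real.exp (3 * ℓ)⌉₊ with hN
  have hNge : Real.exp (3 * ℓ) ≤ N := Nat.le_ceil _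
  have hNlt : (N : ℝ) < Real.exp (3 * ℓ) + 1 := Nat.ceil_lt_add_one (Real.exp_pos _).le
  have hexp3 : (25 : ℝ) ≤ Real.exp (3 * ℓ) := by
    have := Real.add_one_le_exp (3 * ℓ); linarith
  have hN2 : 2 ≤ N := by
    have : (2 : ℝ) ≤ N := by linarith
    exact_mod_cast this
  have hN1 : (1 : ℝ) ≤ N := by
    have : 1 ≤ N := by omega
    exact_mod_cast this
  have hxN : 3 * ℓ ≤ Real.log N := by
    rw [← Real.log_exp (3 * ℓ)]
    exact Real.log_le_log (Real.exp_pos _) hNge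
  set E : ℝ := Real.exp (4 * ℓ) with hE
  have hexpℓ : ℓ + 1 ≤ Real.exp ℓ := Real.add_one_le_exp ℓ
  have hN_le : (N : ℝ) ≤ 2 * Real.exp (3 * ℓ) := by linarith
  have hE_eq : Real.exp (3 * ℓ) * Real.exp ℓ = E := by rw [hE, ← Real.exp_add]; ring_nf
  have hNE : (N : ℝ) ≤ E := by
    calc (N : ℝ) ≤ 2 * Real.exp (3 * ℓ) := hN_le
      _ ≤ Real.exp (3 * ℓ) * Real.exp ℓ := by nlinarith [Real.exp_pos (3 * ℓ)]
      _ = E := hE_eq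
  have hlogN : Real.log N ≤ 4 * ℓ := by
    have hNpos : (0 : ℝ) < N := by linarith
    calc Real.log N ≤ Real.log E := Real.log_le_log hNpos hNE
      _ = 4 * ℓ := by rw [hE, Real.log_exp]
  have hD : ‖fordK (SelbergExplicit.smoothing ℓ) s‖ ≤ 8 * E := by
    rw [SelbergApprox.fordK_smoothing_eq_sum_two hℓ0.le hN2 hxN s]
    calc ‖∑ n ∈ Finset.Ico 2 N, ((ArithmeticFunction.vonMangoldt n : ℝ) : ℂ) *
          (SelbergExplicit.smoothing ℓ (Real.log n) : ℂ) * (n : ℂ) ^ (-s)‖ ≤ N * Real.log N :=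
          norm_sum_Ico_le (Real.log_nonneg hN1) fun n hn ↦ norm_term_le hℓ0 hn hs
      _ ≤ (2 * Real.exp (3 * ℓ)) * (4 * ℓ) := mul_le_mul hN_le hlogN (Real.log_nonneg hN1) (by positivity)
      _ = 8 * (Real.exp (3 * ℓ) * ℓ) := by ring
      _ ≤ 8 * (Real.exp (3 * ℓ) * Real.exp ℓ) := by gcongr; linarith
      _ = 8 * E := by rw [hE_eq]
  have hM : ‖∑ n ∈ Finset.Ico 2 N, ((ArithmeticFunction.vonMangoldt n : ℝ) : ℂ) *
      (SelbergExplicit.smoothing ℓ (Real.log n) : ℂ) * ((n : ℂ) ^ (-s) / (Real.log n : ℂ))‖ ≤ 2 * E := by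
    have h := norm_sum_Ico_le zero_le_one fun n hn ↦ norm_term_div_log_le (N := N) hℓ0 hn hs
    rw [mul_one] at h
    linarith
  exact ⟨hN2, hxN, hD, hM⟩

/-- **The analytic core** (the proof of `SelbergApprox.selberg_approx_pointwise` with real parts,
under RH): for `ℓ ≥ 8`, `1 ≤ t`, `ℓ ≤ 2 log t`, `ζ(½+it) ≠ 0`, `δ₁ = delta ℓ t`, `s₁ = ½ + δ₁ + it`
and any `N ≥ 2` with `3ℓ ≤ log N`,
`log |ζ(½+it)| ≤ δ₁ ‖ζ'/ζ(s₁)‖ + δ₁ W + δ₁(4/t + log(|t|+4) + 10) + ‖M‖ + K + (3/10) W/ℓ`.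
[cite: Titchmarsh1986, §14.21] -/
theorem log_norm_zeta_half_le_core (hRH : RiemannHypothesis) {ℓ t : ℝ} (hℓ : 8 ≤ ℓ) (ht : 1 ≤ t)
    (hℓt : ℓ ≤ 2 * Real.log t) (h0 : riemannZeta (1 / 2 + t * I) ≠ 0) {N : ℕ} (hN : 2 ≤ N)
    (hxN : 3 * ℓ ≤ Real.log N) :
    Real.log ‖riemannZeta (1 / 2 + t * I)‖ ≤
      SelbergSigma.delta ℓ t *
          ‖deriv riemannZeta ((((1 / 2 + SelbergSigma.delta ℓ t : ℝ)) : ℂ) + t * I) /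
            riemannZeta ((((1 / 2 + SelbergSigma.delta ℓ t : ℝ)) : ℂ) + t * I)‖ +
        (SelbergSigma.delta ℓ t * SelbergSigma.W ℓ t +
          (4 / t + Real.log (|t| + 4) + 10) * SelbergSigma.delta ℓ t) +
        ‖∑ n ∈ Finset.Ico 2 N, ((ArithmeticFunction.vonMangoldt n : ℝ) : ℂ) *
            (SelbergExplicit.smoothing ℓ (Real.log n) : ℂ) *
            ((n : ℂ) ^ (-((((1 / 2 + SelbergSigma.delta ℓ t : ℝ)) : ℂ) + t * I)) / (Real.log n : ℂ))‖ +
        (Real.exp 1 * (4 / ℓ ^ 2 + SelbergExplicit.norm_remainder_le.choose * (1 + Real.log (1 + |t|)) *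
            Real.exp (-ℓ) / ℓ ^ 2 +
          (∑' n : ℕ, (ArithmeticFunction.vonMangoldt n : ℝ) * (n : ℝ) ^ (-(5 / 4 : ℝ))) *
            Real.exp (-(ℓ / 4))) +
          3 / 10 * SelbergSigma.W ℓ t / ℓ) := by
  have hℓ0 : 0 < ℓ := by linarith
  have hℓ4 : 4 < ℓ := by linarith
  have ht0 : 0 < t := by linarith
  have hT' := not_ordinate_of_RH hRH ht0 h0
  -- the analytic inputs (raw form)
  have hlog := log_norm_zeta_half_eq_neg_re_integral ht0 hT'
  have hright := norm_integral_right_add_le hℓ ht hℓt hT' hN hxN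
  have hseg := re_integral_segment_le hRH hℓ4 ht hT'
  -- the local vocabulary
  set δ := SelbergSigma.delta ℓ t with hδ
  have hδ0 : 0 < δ := SelbergSigma.delta_pos hℓ0 t
  set σ₁ : ℝ := 1 / 2 + δ with hσ₁
  have hσ₁h : (1 / 2 : ℝ) ≤ σ₁ := by rw [hσ₁]; linarith
  set Fc : ℝ → ℂ := fun σ ↦ deriv riemannZeta (σ + t * I) / riemannZeta (σ + t * I) with hFc
  set M : ℂ := ∑ n ∈ Finset.Ico 2 N, ((ArithmeticFunction.vonMangoldt n : ℝ) : ℂ) *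
      (SelbergExplicit.smoothing ℓ (Real.log n) : ℂ) *
        ((n : ℂ) ^ (-(((σ₁ : ℝ) : ℂ) + t * I)) / (Real.log n : ℂ)) with hM
  set W : ℝ := SelbergSigma.W ℓ t with hW
  set K : ℝ := Real.exp 1 * (4 / ℓ ^ 2 + SelbergExplicit.norm_remainder_le.choose *
    (1 + Real.log (1 + |t|)) * Real.exp (-ℓ) / ℓ ^ 2 +
    (∑' n : ℕ, (ArithmeticFunction.vonMangoldt n : ℝ) * (n : ℝ) ^ (-(5 / 4 : ℝ))) *
      Real.exp (-(ℓ / 4))) with hK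
  -- restatements in the local vocabulary
  have hlog' : Real.log ‖riemannZeta (1 / 2 + t * I)‖ = -(∫ σ in Ioi (1 / 2 : ℝ), Fc σ).re := hlog
  have hright' : ‖(∫ σ in Ioi σ₁, Fc σ) + M‖ ≤ K + 3 / 10 * W / ℓ := hright
  have hseg' : (∫ σ in (1 / 2 : ℝ)..σ₁, (Fc σ₁ - Fc σ)).re ≤
      δ * W + (4 / t + Real.log (|t| + 4) + 10) * δ := hseg
  clear hlog hright hseg
  -- split the ray at `σ₁`
  have hFint : IntegrableOn Fc (Ioi (1 / 2 : ℝ)) := integrableOn_logDeriv_riemannZeta_Ioi_half ht0 hT'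
  have hF1 : IntegrableOn Fc (Ioc (1 / 2 : ℝ) σ₁) := hFint.mono_set Ioc_subset_Ioi_self
  have hF2 : IntegrableOn Fc (Ioi σ₁) := hFint.mono_set (Ioi_subset_Ioi hσ₁h)
  have hsplit : ∫ σ in Ioi (1 / 2 : ℝ), Fc σ = (∫ σ in (1 / 2 : ℝ)..σ₁, Fc σ) + ∫ σ in Ioi σ₁, Fc σ := by
    rw [intervalIntegral.integral_of_le hσ₁h,
      ← setIntegral_union (Ioc_disjoint_Ioi le_rfl) measurableSet_Ioi hF1 hF2,
      Ioc_union_Ioi_eq_Ioi hσ₁h]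
  have hFii : IntervalIntegrable Fc volume (1 / 2) σ₁ :=
    (intervalIntegrable_iff_integrableOn_Ioc_of_le hσ₁h).2 hF1
  have hJ23 : ∫ σ in (1 / 2 : ℝ)..σ₁, Fc σ = δ * Fc σ₁ - ∫ σ in (1 / 2 : ℝ)..σ₁, (Fc σ₁ - Fc σ) := by
    rw [intervalIntegral.integral_sub intervalIntegrable_const hFii, intervalIntegral.integral_const,
      show σ₁ - 1 / 2 = δ by rw [hσ₁]; ring]
    simp
  have hkey : Real.log ‖riemannZeta (1 / 2 + t * I)‖ =
      -(δ * (Fc σ₁).re) + (∫ σ in (1 / 2 : ℝ)..σ₁, (Fc σ₁ - Fc σ)).re + M.re -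
        ((∫ σ in Ioi σ₁, Fc σ) + M).re := by
    rw [hlog', hsplit, hJ23]
    simp only [Complex.add_re, Complex.sub_re, Complex.re_ofReal_mul]
    ring
  rw [hkey]
  have a1 : -(δ * (Fc σ₁).re) ≤ δ * ‖Fc σ₁‖ := by
    have := (abs_le.1 (Complex.abs_re_le_norm (Fc σ₁))).1
    nlinarith
  have a3 : M.re ≤ ‖M‖ := (le_abs_self _).trans (Complex.abs_re_le_norm M)
  have a4 : -((∫ σ in Ioi σ₁, Fc σ) + M).re ≤ K + 3 / 10 * W / ℓ := by
    have := (abs_le.1 (Complex.abs_re_le_norm ((∫ σ in Ioi σ₁, Fc σ) + M))).1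
    linarith
  linarith [hseg']

/-- **The bookkeeping of constants** (pure real arithmetic): with `δ = 4/ℓ`, `ℓ ≥ 8`,
`4 ≤ L = log t`, `ℓ ≤ 2L`, and the sizes `‖D‖ ≤ 8e^{4ℓ}`, `‖M‖ ≤ 2e^{4ℓ}`, `W ≤ 6‖D‖ + C_W L`,
`‖ζ'/ζ(s₁)‖ ≤ ‖D‖ + 4/ℓ² + (3/10)W + C_J(1 + log(1+|t|))`, the right side of
`log_norm_zeta_half_le_core` is `≤ (60 + 3B₀ + 7C_W + 9C_J)(e^{4ℓ} + L/ℓ)`. [folklore] -/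
theorem bookkeeping {ℓ L δ W nD nM nF CW CJ B₀ t : ℝ} (hℓ : 8 ≤ ℓ) (hL4 : 4 ≤ L)
    (hℓt : ℓ ≤ 2 * L) (ht2 : 2 ≤ t) (hCW0 : 0 ≤ CW) (hCJ0 : 0 ≤ CJ) (hB₀0 : 0 ≤ B₀)
    (hnD0 : 0 ≤ nD) (hδeq : δ = 4 / ℓ) (hnD : nD ≤ 8 * Real.exp (4 * ℓ)) (hnM : nM ≤ 2 * Real.exp (4 * ℓ))
    (hWle : W ≤ 6 * nD + CW * L)
    (hF : nF ≤ nD + 4 / ℓ ^ 2 + 3 / 10 * W + CJ * (1 + Real.log (1 + |t|)))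
    (hlog1t : Real.log (1 + |t|) ≤ 1 + L) (hlogt4 : Real.log (|t| + 4) ≤ 2 + L) :
    δ * nF + (δ * W + (4 / t + Real.log (|t| + 4) + 10) * δ) + nM +
        (Real.exp 1 * (4 / ℓ ^ 2 + CJ * (1 + Real.log (1 + |t|)) * Real.exp (-ℓ) / ℓ ^ 2 +
            B₀ * Real.exp (-(ℓ / 4))) + 3 / 10 * W / ℓ) ≤
      (60 + 3 * B₀ + 7 * CW + 9 * CJ) * (Real.exp (4 * ℓ) + L / ℓ) := by
  have hℓ0 : 0 < ℓ := by linarith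
  have ht0 : 0 < t := by linarith
  have hδ0 : 0 < δ := by rw [hδeq]; positivity
  have hδhalf : δ ≤ 1 / 2 := by rw [hδeq, div_le_iff₀ hℓ0]; linarith
  set E : ℝ := Real.exp (4 * ℓ) with hE
  set X : ℝ := L / ℓ with hX
  have hE1 : 1 ≤ E := Real.one_le_exp (by positivity)
  have hW' : W ≤ 48 * E + CW * L := by linarith
  have hX_half : 1 / 2 ≤ X := by rw [hX, le_div_iff₀ hℓ0]; linarith
  have hX0 : 0 ≤ X := by linarith
  have hδL : δ * L = 4 * X := by rw [hδeq, hX]; field_simp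
  have h4t : 4 / t ≤ 2 := by rw [div_le_iff₀ ht0]; linarith
  have h88 : (8 : ℝ) * 8 ≤ ℓ * ℓ := mul_le_mul hℓ hℓ (by norm_num) hℓ0.le
  have hℓ2 : 64 ≤ ℓ ^ 2 := by rw [sq]; linarith
  have hCWX : 0 ≤ CW * X := by positivity
  have hCJX : 0 ≤ CJ * X := by positivity
  -- (b) `δ W`
  have hδD : δ * nD ≤ 4 * E := by
    calc δ * nD ≤ 1 / 2 * nD := mul_le_mul_of_nonneg_right hδhalf hnD0
      _ ≤ 4 * E := by linarith
  have hb : δ * W ≤ 24 * E + 4 * (CW * X) := by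
    have h1 := mul_le_mul_of_nonneg_left hW' hδ0.le
    have e : δ * (48 * E + CW * L) = 12 * (δ * (4 * E)) + CW * (δ * L) := by ring
    rw [e, hδL, show CW * (4 * X) = 4 * (CW * X) by ring] at h1
    have h2 : δ * (4 * E) ≤ 1 / 2 * (4 * E) := mul_le_mul_of_nonneg_right hδhalf (by positivity)
    linarith
  -- (a) `δ ‖ζ'/ζ(s₁)‖`
  have ha1 : δ * (4 / ℓ ^ 2) ≤ E := by
    have h1 : 4 / ℓ ^ 2 ≤ 1 := by rw [div_le_one (by positivity)]; linarith
    have : δ * (4 / ℓ ^ 2) ≤ 1 / 2 * 1 := mul_le_mul hδhalf h1 (by positivity) (by norm_num)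
    linarith
  have ha2 : δ * (CJ * (1 + Real.log (1 + |t|))) ≤ 6 * (CJ * X) := by
    have h1 : 1 + Real.log (1 + |t|) ≤ 2 + L := by linarith
    have h2 : δ * (1 + Real.log (1 + |t|)) ≤ δ * (2 + L) := mul_le_mul_of_nonneg_left h1 hδ0.le
    rw [show δ * (2 + L) = 2 * δ + δ * L by ring, hδL] at h2
    have h4 : δ * (1 + Real.log (1 + |t|)) ≤ 6 * X := by linarith
    calc δ * (CJ * (1 + Real.log (1 + |t|))) = CJ * (δ * (1 + Real.log (1 + |t|))) := by ring
      _ ≤ CJ * (6 * X) := mul_le_mul_of_nonneg_left h4 hCJ0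
      _ = 6 * (CJ * X) := by ring
  have ha : δ * nF ≤ 13 * E + 2 * (CW * X) + 6 * (CJ * X) := by
    have h0 := mul_le_mul_of_nonneg_left hF hδ0.le
    have e1 : δ * (nD + 4 / ℓ ^ 2 + 3 / 10 * W + CJ * (1 + Real.log (1 + |t|))) =
        δ * nD + δ * (4 / ℓ ^ 2) + 3 / 10 * (δ * W) + δ * (CJ * (1 + Real.log (1 + |t|))) := by ring
    rw [e1] at h0
    linarith [hδD, ha1, hb, ha2]
  -- (c) the pole and `Γ` terms
  have hc : (4 / t + Real.log (|t| + 4) + 10) * δ ≤ 7 * E + 4 * X := by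
    have h1 : 4 / t + Real.log (|t| + 4) + 10 ≤ 14 + L := by linarith
    have h2 := mul_le_mul_of_nonneg_right h1 hδ0.le
    rw [show (14 + L) * δ = 14 * δ + δ * L by ring, hδL] at h2
    linarith
  -- (e) `K`
  have he : Real.exp 1 * (4 / ℓ ^ 2 + CJ * (1 + Real.log (1 + |t|)) * Real.exp (-ℓ) / ℓ ^ 2 +
      B₀ * Real.exp (-(ℓ / 4))) ≤ E + 3 * (CJ * X) + 3 * (B₀ * E) := by
    have k1 : 4 / ℓ ^ 2 ≤ 1 / 16 := by rw [div_le_iff₀ (by positivity)]; linarith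
    have heℓ : Real.exp (-ℓ) ≤ 1 := by rw [Real.exp_le_one_iff]; linarith
    have hlog0 : 0 ≤ Real.log (1 + |t|) := Real.log_nonneg (by linarith [abs_nonneg t])
    have k2a : CJ * (1 + Real.log (1 + |t|)) * Real.exp (-ℓ) ≤ CJ * (2 + L) := by
      calc CJ * (1 + Real.log (1 + |t|)) * Real.exp (-ℓ) ≤ CJ * (1 + Real.log (1 + |t|)) * 1 :=
            mul_le_mul_of_nonneg_left heℓ (by positivity)
        _ ≤ CJ * (2 + L) := by rw [mul_one]; exact mul_le_mul_of_nonneg_left (by linarith) hCJ0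
    have k2b : (2 + L) / ℓ ^ 2 ≤ X := by
      rw [div_le_iff₀ (by positivity), hX]
      have : L / ℓ * ℓ ^ 2 = L * ℓ := by field_simp
      rw [this]
      have := mul_le_mul_of_nonneg_left hℓ (by linarith : (0 : ℝ) ≤ L)
      linarith
    have k2 : CJ * (1 + Real.log (1 + |t|)) * Real.exp (-ℓ) / ℓ ^ 2 ≤ CJ * X := by
      calc CJ * (1 + Real.log (1 + |t|)) * Real.exp (-ℓ) / ℓ ^ 2 ≤ CJ * (2 + L) / ℓ ^ 2 :=
            div_le_div_of_nonneg_right k2a (by positivity)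
        _ = CJ * ((2 + L) / ℓ ^ 2) := by ring
        _ ≤ CJ * X := mul_le_mul_of_nonneg_left k2b hCJ0
    have k3 : B₀ * Real.exp (-(ℓ / 4)) ≤ B₀ :=
      mul_le_of_le_one_right hB₀0 (by rw [Real.exp_le_one_iff]; linarith)
    have hsum : 4 / ℓ ^ 2 + CJ * (1 + Real.log (1 + |t|)) * Real.exp (-ℓ) / ℓ ^ 2 +
        B₀ * Real.exp (-(ℓ / 4)) ≤ 1 / 16 + CJ * X + B₀ := by linarith
    have hpos : 0 ≤ 4 / ℓ ^ 2 + CJ * (1 + Real.log (1 + |t|)) * Real.exp (-ℓ) / ℓ ^ 2 +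
        B₀ * Real.exp (-(ℓ / 4)) := by positivity
    have he3 : Real.exp 1 ≤ 3 := by have := Real.exp_one_lt_d9; linarith
    have hBE : B₀ ≤ B₀ * E := le_mul_of_one_le_right hB₀0 hE1
    calc Real.exp 1 * (4 / ℓ ^ 2 + CJ * (1 + Real.log (1 + |t|)) * Real.exp (-ℓ) / ℓ ^ 2 +
          B₀ * Real.exp (-(ℓ / 4))) ≤ 3 * (1 / 16 + CJ * X + B₀) := mul_le_mul he3 hsum hpos (by norm_num)
      _ ≤ E + 3 * (CJ * X) + 3 * (B₀ * E) := by linarith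
  -- (f) `(3/10) W/ℓ`
  have hf : 3 / 10 * W / ℓ ≤ 2 * E + CW * X := by
    have h1 : W / ℓ ≤ 6 * E + CW * X := by
      rw [div_le_iff₀ hℓ0]
      have e : (6 * E + CW * X) * ℓ = 6 * E * ℓ + CW * L := by rw [hX]; field_simp
      rw [e]
      have h48 : (6 * E) * 8 ≤ (6 * E) * ℓ := mul_le_mul_of_nonneg_left hℓ (by positivity)
      linarith
    rw [show 3 / 10 * W / ℓ = 3 / 10 * (W / ℓ) by ring]
    linarith [h1, hCWX, hE1]
  -- conclusion
  have hfinal : δ * nF + (δ * W + (4 / t + Real.log (|t| + 4) + 10) * δ) + nM +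
      (Real.exp 1 * (4 / ℓ ^ 2 + CJ * (1 + Real.log (1 + |t|)) * Real.exp (-ℓ) / ℓ ^ 2 +
        B₀ * Real.exp (-(ℓ / 4))) + 3 / 10 * W / ℓ) ≤
      49 * E + 4 * X + 3 * (B₀ * E) + 7 * (CW * X) + 9 * (CJ * X) := by
    linarith [ha, hb, hc, hnM, he, hf]
  have e : (60 + 3 * B₀ + 7 * CW + 9 * CJ) * (E + X) =
      60 * E + 60 * X + 3 * (B₀ * E) + 3 * (B₀ * X) + 7 * (CW * E) + 7 * (CW * X) +
        9 * (CJ * E) + 9 * (CJ * X) := by ring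
  rw [e]
  have p1 : 0 ≤ B₀ * X := by positivity
  have p2 : 0 ≤ CW * E := by positivity
  have p3 : 0 ≤ CJ * E := by positivity
  linarith [hE1]

/-- **The parametric bound under RH.** There is an absolute `A > 0` such that, on RH, for
`ℓ ≥ 8`, `t ≥ 2`, `ℓ ≤ 2 log t` and `ζ(½ + it) ≠ 0`:
`log |ζ(½ + it)| ≤ A (e^{4ℓ} + log t/ℓ)` (`x = e^ℓ`; the first term bounds the Dirichlet
polynomials `Σ_{n<x³} Λ_x(n) n^{−s}` crudely, the second is `(σ_{x,t} − ½) log t = 4 log t/ℓ` up to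
constants). [cite: Titchmarsh1986, Thm. 14.14 (A)] -/
theorem log_norm_zeta_half_le_param (hRH : RiemannHypothesis) :
    ∃ A : ℝ, 0 < A ∧ ∀ ℓ t : ℝ, 8 ≤ ℓ → 2 ≤ t → ℓ ≤ 2 * Real.log t →
      riemannZeta (1 / 2 + t * I) ≠ 0 →
      Real.log ‖riemannZeta (1 / 2 + t * I)‖ ≤ A * (Real.exp (4 * ℓ) + Real.log t / ℓ) := by
  obtain ⟨CW, hCW0, hCW⟩ := SelbergSigma.W_le
  obtain ⟨hCJ0, -⟩ := SelbergExplicit.norm_remainder_le.choose_spec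
  set CJ := SelbergExplicit.norm_remainder_le.choose with hCJdef
  set B₀ : ℝ := ∑' n : ℕ, (ArithmeticFunction.vonMangoldt n : ℝ) * (n : ℝ) ^ (-(5 / 4 : ℝ)) with hB₀
  have hB₀0 : 0 ≤ B₀ := tsum_nonneg fun n ↦ mul_nonneg ArithmeticFunction.vonMangoldt_nonneg
    (Real.rpow_nonneg (Nat.cast_nonneg n) _)
  refine ⟨60 + 3 * B₀ + 7 * CW + 9 * CJ, by positivity, fun ℓ t hℓ ht2 hℓt h0 ↦ ?_⟩
  have hℓ0 : 0 < ℓ := by linarith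
  have ht0 : 0 < t := by linarith
  have ht1 : 1 ≤ t := by linarith
  have hL4 : 4 ≤ Real.log t := by linarith
  have hs₁re : 0 ≤ ((((1 / 2 + SelbergSigma.delta ℓ t : ℝ)) : ℂ) + t * I).re := by
    have := SelbergSigma.delta_pos hℓ0 t
    simp only [add_re, ofReal_re, mul_re, I_re, mul_zero, ofReal_im, I_im, mul_one, sub_self,
      add_zero]
    linarith
  obtain ⟨hN2, hxN, hnD, hnM⟩ := dirichlet_sizes hℓ hs₁re
  have hcore := log_norm_zeta_half_le_core hRH hℓ ht1 hℓt h0 hN2 hxN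
  have hF := norm_logDeriv_sigma1_le hℓ ht1 hℓt
  have hWle := hCW ℓ t hℓ ht0 hℓt
  have hδeq := delta_eq_of_RH hRH hℓ0 t
  have hlog2 : Real.log 2 ≤ 1 := by have := Real.log_two_lt_d9; linarith
  have hlog1t : Real.log (1 + |t|) ≤ 1 + Real.log t := by
    rw [abs_of_pos ht0]
    have : Real.log (1 + t) ≤ Real.log (2 * t) := Real.log_le_log (by linarith) (by linarith)
    rw [Real.log_mul (by norm_num) ht0.ne'] at this
    linarith
  have hlogt4 : Real.log (|t| + 4) ≤ 2 + Real.log t := by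
    rw [abs_of_pos ht0]
    have h1 : Real.log (t + 4) ≤ Real.log (4 * t) := Real.log_le_log (by linarith) (by linarith)
    have h2 : Real.log (4 * t) = Real.log 4 + Real.log t := Real.log_mul (by norm_num) ht0.ne'
    have hlog4 : Real.log 4 ≤ 2 := by
      rw [show (4 : ℝ) = 2 ^ 2 by norm_num, Real.log_pow]; push_cast; linarith
    linarith
  have hbk := bookkeeping hℓ hL4 hℓt ht2 hCW0.le hCJ0.le hB₀0 (norm_nonneg _) hδeq hnD hnM
    hWle hF hlog1t hlogt4
  exact hcore.trans hbk

/-! ## Titchmarsh (14.14.1) -/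

/-- **Titchmarsh's Theorem 14.14 (A), logarithmic form.** On RH there is an absolute `C > 0`
with `log |ζ(½ + it)| ≤ C log t / log log t` for all `t ≥ exp(exp 96)` at which
`ζ(½ + it) ≠ 0` (choose `ℓ = (log log t)/12` in `log_norm_zeta_half_le_param`).
[cite: Titchmarsh1986, Thm. 14.14 (A), eq. (14.14.1)] -/
theorem exists_log_norm_zeta_half_le_of_RH (hRH : RiemannHypothesis) :
    ∃ C : ℝ, 0 < C ∧ ∀ t : ℝ, Real.exp (Real.exp 96) ≤ t → riemannZeta (1 / 2 + t * I) ≠ 0 →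
      Real.log ‖riemannZeta (1 / 2 + t * I)‖ ≤ C * Real.log t / Real.log (Real.log t) := by
  obtain ⟨A, hA0, hA⟩ := log_norm_zeta_half_le_param hRH
  refine ⟨15 * A, by positivity, fun t ht h0 ↦ ?_⟩
  set L := Real.log t with hL
  set L₂ := Real.log L with hL₂
  have hee : 0 < Real.exp (Real.exp 96) := Real.exp_pos _
  have ht0 : 0 < t := hee.trans_le ht
  have hLge : Real.exp 96 ≤ L := by
    rw [hL, ← Real.log_exp (Real.exp 96)]
    exact Real.log_le_log hee ht
  have hL0 : 0 < L := (Real.exp_pos 96).trans_le hLge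
  have hL₂ge : 96 ≤ L₂ := by
    rw [hL₂, ← Real.log_exp 96]
    exact Real.log_le_log (Real.exp_pos 96) hLge
  have hL₂0 : 0 < L₂ := by linarith
  have hL₂L : L₂ ≤ L := by
    have := Real.add_one_le_exp L₂
    rw [hL₂, Real.exp_log hL0] at this
    rw [hL₂]; linarith
  have ht2 : 2 ≤ t := by
    have h96 : (2 : ℝ) ≤ Real.exp 96 := by have := Real.add_one_le_exp (96 : ℝ); linarith
    have : Real.exp 96 ≤ Real.exp (Real.exp 96) := Real.exp_le_exp.2 (by
      have := Real.add_one_le_exp (96 : ℝ); linarith)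
    linarith
  set ℓ : ℝ := L₂ / 12 with hℓ
  have hℓ8 : 8 ≤ ℓ := by rw [hℓ]; linarith
  have hℓt : ℓ ≤ 2 * L := by rw [hℓ]; linarith
  have h := hA ℓ t hℓ8 ht2 hℓt h0
  -- `e^{4ℓ} = e^{L₂/3} ≤ 3 L / L₂`
  have hE : Real.exp (4 * ℓ) ≤ 3 * L / L₂ := by
    have h4ℓ : 4 * ℓ = L₂ / 3 := by rw [hℓ]; ring
    rw [h4ℓ, le_div_iff₀ hL₂0]
    set y := Real.exp (L₂ / 3) with hy
    have hy1 : 1 ≤ y := Real.one_le_exp (by positivity)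
    have hy3 : L₂ / 3 ≤ y := by have := Real.add_one_le_exp (L₂ / 3); linarith
    have hyL : y * y * y = L := by
      rw [hy, ← Real.exp_add, ← Real.exp_add, show L₂ / 3 + L₂ / 3 + L₂ / 3 = L₂ by ring, hL₂,
        Real.exp_log hL0]
    calc y * L₂ ≤ y * (3 * y) := mul_le_mul_of_nonneg_left (by linarith) (by linarith)
      _ = 3 * (y * y) * 1 := by ring
      _ ≤ 3 * (y * y) * y := mul_le_mul_of_nonneg_left hy1 (by positivity)
      _ = 3 * L := by rw [← hyL]; ring
  have hX : L / ℓ = 12 * L / L₂ := by rw [hℓ]; field_simp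
  calc Real.log ‖riemannZeta (1 / 2 + t * I)‖ ≤ A * (Real.exp (4 * ℓ) + L / ℓ) := h
    _ ≤ A * (3 * L / L₂ + 12 * L / L₂) := by rw [hX]; gcongr
    _ = 15 * A * L / L₂ := by ring

/-- **Titchmarsh's Theorem 14.14 (A)** (RH): `ζ(½ + it) = O(exp(A log t / log log t))`, in the
form: there is `C > 0` with `|ζ(½ + it)| ≤ exp(C log t / log log t)` for all `t ≥ exp(exp 96)`.
[cite: Titchmarsh1986, Thm. 14.14 (A), eq. (14.14.1)] -/
theorem exists_norm_zeta_half_le_exp_of_RH (hRH : RiemannHypothesis) :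
    ∃ C : ℝ, 0 < C ∧ ∀ t : ℝ, Real.exp (Real.exp 96) ≤ t →
      ‖riemannZeta (1 / 2 + t * I)‖ ≤ Real.exp (C * Real.log t / Real.log (Real.log t)) := by
  obtain ⟨C, hC0, hC⟩ := exists_log_norm_zeta_half_le_of_RH hRH
  refine ⟨C, hC0, fun t ht ↦ ?_⟩
  by_cases h0 : riemannZeta (1 / 2 + t * I) = 0
  · rw [h0, norm_zero]; exact (Real.exp_pos _).le
  · calc ‖riemannZeta (1 / 2 + t * I)‖ = Real.exp (Real.log ‖riemannZeta (1 / 2 + t * I)‖) :=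
          (Real.exp_log (norm_pos_iff.2 h0)).symm
      _ ≤ Real.exp (C * Real.log t / Real.log (Real.log t)) := Real.exp_le_exp.2 (hC t ht h0)

end CriticalLineRH

end Literature.NumberTheory.LFunctions
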